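import Summits.QuantumAdvantage.QuantumAdvantage.Theorems.SosSandwichTransferPBGapAdvisor
import Summits.QuantumAdvantage.QuantumAdvantage.Theorems.SosSandwichTransferPBQueryHalfPB
import HarnessLib

/-!
# Crux `TransferPB` (stmt-QuantumAdvantage-15238, route SosSandwich), line `birth` — `stub_pbOracleSimulation` REDUCED TO ITS MACHINE

Stub `stub_pbOracleSimulation` (`Sig.stub_oracleAcceptPseudoBounded → PseudoBoundedAA → OracleSimulation`,
Aaronson–Ambainis 2014 Thm. 23 relative to a promise-`BQP` oracle, under PB-AA) has a QUERY half — landed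
(`Theorems/SosSandwichTransferPB{SimTreePB,SimTreeOnPB,QueryHalfPB,AdvisedTree,GapAdvisor}.lean`) — and a
MACHINE half. This file closes the gap between the two: it proves the stub from ONE explicit hypothesis about
machines (no named fact, D-0026 — the hypothesis is a plain `Prop` argument, exactly as the tree's
`aaronsonAmbainis2014_thm23_apx_of_dyadicMachines` isolates the `P^{#P}` machine of the unweakened theorem):

> for all constants `c k : ℕ`, every uniform Clifford+T oracle family `F` and every polynomial `r`, there are
> ONE promise problem `Q ∈ PromiseBQP` and ONE deterministic polynomial-time transcript machine `C` (budget `q`)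
> such that for every input `x` (`n ≥ 1`) and every answer function `g` correct on `Q`'s promise there are
> path-indexed influence-test answers `infBig` — forced to `true` when `Inf_i[p_x|_ρ] ≥ w` and to `false` when
> `≤ w/2` — and `1/20`-accurate mean estimates `est` of the restrictions of the acceptance polynomial `p_x`,
> for which `C^{A ⊕ g}(x)` outputs the threshold bit `[t(A) ≥ 1/2]` of the ADVISED TREE `t` driven by these
> answers ("query the least variable whose influence test passes, stop if none; output the estimate"), with the
> explicit influence threshold `w = 2^{-k}·((θ/2)/d)^c`, `θ = δ/200`, `δ = 1/(r(n)+1)`, `d = 2·#gates + 1`,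
> and budget `⌈8d/((w/2)δ)⌉`.

Everything else is proved here:

* `gapAdvisor_noVar_sound` — the advisor WITHOUT a variance test (variance answer hard-wired to `true`) is
  sound `(θ, w/2, η)` granted faithful influence answers and COMPLETENESS (`Var > θ/2 ⇒ ∃ Inf_i ≥ w`): the
  variance test of Aaronson–Ambainis' Thm. 21 is redundant once completeness holds, so the promise problem
  only has to encode influence tests and mean thresholds (both acceptance probabilities of ONE two-run
  circuit each — the variance is not of that form);
* `measure_advTree_acceptPoly_deviation_le` — for ANY sound advisor on `p_x`, the advised tree with budget
  `D ≥ 8d/(wδ)` deviates from `Pr[F^A accepts x]` by more than `ε + η` with random-oracle probability `≤ δ`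
  (counting bound `advTree_error_le` + uniformity of the relevant oracle bits);
* `measure_advTree_noVar_deviation_le_pb` — the same for the no-variance gapped advisor under the PB-AA
  influence bound at constants `(c, C₀)` and `p_x ∈ K_{#gates}` (completeness = `complete_of_pb`);
* `threshold_subset_deviation` — with `ε + η < 1/6` the thresholded error event of `OracleSimulation` lies in
  the deviation event;
* `pbBound_dyadic` — PB-AA with constant `C₀ > 0` implies PB-AA with a DYADIC constant `2^{-k} ≤ C₀` (so the
  machine works with rational thresholds);
* **`oracleSimulation_of_machines`**, **`stub_pbOracleSimulation_of_machines`** — the stub from the machine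
  hypothesis (stub 1 `stub_oracleAcceptPseudoBounded` is landed and supplies `p_x ∈ K_{#gates}`).

What remains for the stub after this file is the hypothesis ALONE: (M1) a string encoding of the node tests
`⟨x, ρ, i⟩` / `⟨x, ρ, t⟩` as one promise problem `Q_F`; (M2) `Q_F ∈ PromiseBQP` (uniform two-run estimator
circuits over a `4T`-wise independent hashed completion of the restriction, `½ + ¼·Inf_i` as an acceptance
probability; mean thresholds; amplification); (M3) the transcript machine walking the advised tree with the
combined oracle `A ⊕ g` (binary search for `est`), polynomial time. Source: S. Aaronson, A. Ambainis, Theory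
Comput. 10 (2014), Thm. 21, Thm. 23 and its proof (arXiv:0911.0996v3 pp. 13–14).
-/

-- D-0017: single-conjunct summit ⇒ the duplicate `QuantumAdvantage.QuantumAdvantage` is mandated.
set_option linter.dupNamespace false

noncomputable section

namespace Summit.QuantumAdvantage.QuantumAdvantage.Cruxes.TransferPB.Birth

open Finset MeasureTheory Literature.Computability.Cryptography Literature.Computability.Complexity
  Literature.Computability.QuantumComplexity Literature.Computability.QuantumComplexity.ClassicalSimulation
open Summit.QuantumAdvantage.QuantumAdvantage.Theses.SosSandwich
open scoped ENNReal

namespace SimTreePB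

/-! ### The gapped advisor without a variance test -/

section NoVar

variable {N : ℕ}

/-- **The no-variance gapped advisor is sound.** Hard-wire the variance answer to `true` in `gapAdvisor`: the
rule becomes "query the least `i` whose influence test passes; stop if none". Granted faithful influence
answers (`Inf_i ≥ w ⇒ true`, `Inf_i ≤ w/2 ⇒ false`), `η`-accurate estimates and COMPLETENESS
(`Var[p|_ρ] > θ/2 ⇒ ∃ i, Inf_i[p|_ρ] ≥ w`), it is sound with parameters `(θ, w/2, η)`: a picked variable passed
its test (`Inf > w/2`); a refusal means every test failed, so no influence is `≥ w`, so `Var ≤ θ/2 ≤ θ`.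
[cite: AaronsonAmbainis2014, Thm. 21 (proof) and Thm. 23 (proof, p. 14)] -/
theorem gapAdvisor_noVar_sound {infBig : List (Fin N × Bool) → Fin N → Bool} {est : List (Fin N × Bool) → ℝ}
    {p : MvPolynomial (Fin N) ℝ} {θ w η : ℝ} (hθ : 0 ≤ θ)
    (hinf : ∀ (ρ : List (Fin N × Bool)) (i : Fin N),
      (w ≤ influence i (restrictPath ρ p) → infBig ρ i = true) ∧
      (influence i (restrictPath ρ p) ≤ w / 2 → infBig ρ i = false))
    (hest : ∀ ρ : List (Fin N × Bool), |est ρ - boolAvg (evalBool (restrictPath ρ p))| ≤ η)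
    (hcomplete : ∀ ρ : List (Fin N × Bool), θ / 2 < boolVariance (restrictPath ρ p) →
      ∃ i : Fin N, w ≤ influence i (restrictPath ρ p)) :
    (gapAdvisor ⟨fun _ => true, infBig, est⟩).Sound p θ (w / 2) η := by
  refine ⟨fun ρ i hpick => ?_, fun ρ hnone => ?_, fun ρ => hest ρ⟩
  · obtain ⟨-, hi⟩ := infBig_of_gapAdvisor_pick hpick
    by_contra hlt
    have hsmall : influence i (restrictPath ρ p) ≤ w / 2 := (not_le.1 hlt).le
    have := (hinf ρ i).2 hsmall
    simp only at hi
    rw [this] at hi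
    exact Bool.false_ne_true hi
  · rcases gapAdvisor_pick_eq_none hnone with hv | hall
    · exact absurd hv (by simp)
    · by_contra hbig
      have hbig' : θ / 2 < boolVariance (restrictPath ρ p) := by
        have : θ / 2 ≤ θ := by linarith
        exact lt_of_le_of_lt this (not_le.1 hbig)
      obtain ⟨i, hi⟩ := hcomplete ρ hbig'
      have := (hinf ρ i).1 hi
      simp only at hall
      rw [hall i] at this
      exact Bool.false_ne_true this

end NoVar

/-! ### From counting to measure: advised trees on the acceptance polynomial -/

section Measure

variable {G : QGateSet} (F : QCircuitFamily G) (x : List Bool)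

/-- **Deviation bound for advised trees on `p_x`, over the random oracle.** For ANY advisor sound for the
acceptance polynomial `p_x = acceptPoly F x` (degree `≤ d`, `d ≥ 1`, values in `[0,1]`) with parameters
`(ε²δ/2, w, η)` and a budget `D ≥ 8d/(wδ)`: `μ {A | |t(A) − Pr[F^A accepts x]| > ε + η} ≤ δ`
(`advTree_error_le` + the relevant oracle bits are uniform, `randomOracleMeasure_oracleBits_mem`).
[cite: AaronsonAmbainis2014, Thm. 21 and proof of Thm. 23 (p. 14)] -/
theorem measure_advTree_acceptPoly_deviation_le {Adv : Advisor (numOracleBits F x)} {d : ℕ} (hd1 : 1 ≤ d)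
    (hdeg : (acceptPoly F x).totalDegree ≤ d)
    (hbd : ∀ b, 0 ≤ evalBool (acceptPoly F x) b ∧ evalBool (acceptPoly F x) b ≤ 1)
    {ε δ w η : ℝ} (hε : 0 < ε) (hδ : 0 < δ) (hw : 0 < w)
    (hS : Adv.Sound (acceptPoly F x) (ε ^ 2 * δ / 2) w η) {D : ℕ} (hD : 8 * (d : ℝ) / (w * δ) ≤ D) :
    randomOracleMeasure {A : Set (List Bool) |
        ε + η < |(advTree Adv D []).eval (oracleBits F x A) - F.acceptProbOn A x|} ≤ ENNReal.ofReal δ := by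
  classical
  set t := advTree Adv D [] with ht
  have herr := advTree_error_le (A := Adv) hd1 hdeg hbd hε hδ hw hS hD
  rw [← ht] at herr
  have hset : {A : Set (List Bool) | ε + η < |t.eval (oracleBits F x A) - F.acceptProbOn A x|} =
      {A : Set (List Bool) |
        oracleBits F x A ∈ univ.filter fun b => ε + η < |t.eval b - evalBool (acceptPoly F x) b|} := by
    ext A
    simp only [Set.mem_setOf_eq, mem_filter, mem_univ, true_and, evalBool_acceptPoly]
  rw [hset, randomOracleMeasure_oracleBits_mem]
  set S := univ.filter fun b : Fin (numOracleBits F x) → Bool =>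
    ε + η < |t.eval b - evalBool (acceptPoly F x) b| with hS'
  have hcard : (S.card : ℝ) ≤ δ * 2 ^ numOracleBits F x := herr
  have hmeas : (S.card : ℝ≥0∞) * 2⁻¹ ^ numOracleBits F x =
      ENNReal.ofReal ((S.card : ℝ) / 2 ^ numOracleBits F x) := by
    rw [ENNReal.ofReal_div_of_pos (by positivity), ENNReal.ofReal_natCast, ENNReal.ofReal_pow (by norm_num),
      ENNReal.ofReal_ofNat, ← ENNReal.inv_pow, div_eq_mul_inv]
  rw [hmeas]
  refine ENNReal.ofReal_le_ofReal ?_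
  rw [div_le_iff₀ (by positivity)]
  exact hcard

/-- **Deviation bound for the no-variance gapped advisor under PB-AA.** If every `q ∈ K_T` (`T ≥ 1`) with
`Var[q] ≥ ε' > 0` has a variable of influence `≥ C₀ (ε'/T)^c`, `p_x ∈ K_{#gates}`, the influence answers are
faithful for the threshold `w = C₀ ((θ/2)/d)^c` (`θ = ε²δ/2`, `d = 2·#gates + 1`) and the estimates are
`η`-accurate, then the advised tree with budget `D ≥ 8d/((w/2)δ)` deviates from `Pr[F^A accepts x]` by more
than `ε + η` with probability `≤ δ` (`ε, δ ∈ (0,1]`). Completeness is `complete_of_pb`; the influence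
hypothesis is applied to restrictions of `p_x` only. [cite: AaronsonAmbainis2014, Thm. 23 (proof, p. 14)] -/
theorem measure_advTree_noVar_deviation_le_pb {c : ℕ} {C₀ : ℝ} (hC₀ : 0 < C₀)
    (HPB : ∀ (N T : ℕ) (p : MvPolynomial (Fin N) ℝ) (ε : ℝ), 1 ≤ T → PseudoBounded T p → 0 < ε →
      ε ≤ boolVariance p → ∃ i : Fin N, C₀ * (ε / T) ^ c ≤ influence i p)
    (hK : PseudoBounded (F.circ x.length).oracleQueries (acceptPoly F x))
    {ε δ η : ℝ} (hε : 0 < ε) (hδ : 0 < δ)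
    {infBig : List (Fin (numOracleBits F x) × Bool) → Fin (numOracleBits F x) → Bool}
    {est : List (Fin (numOracleBits F x) × Bool) → ℝ}
    (hinf : ∀ (ρ : List (Fin (numOracleBits F x) × Bool)) (i : Fin (numOracleBits F x)),
      (C₀ * (((ε ^ 2 * δ / 2) / 2) / thm23Degree F x) ^ c ≤ influence i (restrictPath ρ (acceptPoly F x)) →
          infBig ρ i = true) ∧
      (influence i (restrictPath ρ (acceptPoly F x)) ≤ (C₀ * (((ε ^ 2 * δ / 2) / 2) / thm23Degree F x) ^ c) / 2 →
          infBig ρ i = false))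
    (hest : ∀ ρ : List (Fin (numOracleBits F x) × Bool),
      |est ρ - boolAvg (evalBool (restrictPath ρ (acceptPoly F x)))| ≤ η)
    {D : ℕ} (hD : 8 * (thm23Degree F x : ℝ) /
      ((C₀ * (((ε ^ 2 * δ / 2) / 2) / thm23Degree F x) ^ c) / 2 * δ) ≤ D) :
    randomOracleMeasure {A : Set (List Bool) |
        ε + η < |(advTree (gapAdvisor ⟨fun _ => true, infBig, est⟩) D []).eval (oracleBits F x A) -
          F.acceptProbOn A x|} ≤ ENNReal.ofReal δ := by
  have hd1 : 1 ≤ thm23Degree F x := by unfold thm23Degree; omega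
  have hTd : (F.circ x.length).oracleQueries ≤ thm23Degree F x := by unfold thm23Degree; omega
  have hdeg : (acceptPoly F x).totalDegree ≤ thm23Degree F x :=
    (totalDegree_acceptPoly_le F x).trans (by unfold thm23Degree; omega)
  set θ : ℝ := ε ^ 2 * δ / 2 with hθ
  have hθpos : 0 < θ := by positivity
  set w : ℝ := C₀ * ((θ / 2) / thm23Degree F x) ^ c with hw
  have hwpos : 0 < w := by positivity
  have hcomplete := complete_of_pb (N := numOracleBits F x) (c := c) (C := C₀) hTd
    (fun q ε' hq hε' hv => HPB _ _ q ε' hd1 hq hε' hv) hK hθpos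
  have hS : (gapAdvisor ⟨fun _ => true, infBig, est⟩).Sound (acceptPoly F x) θ (w / 2) η :=
    gapAdvisor_noVar_sound hθpos.le hinf hest hcomplete
  exact measure_advTree_acceptPoly_deviation_le F x hd1 hdeg (hK.mono hTd).bounded hε hδ (half_pos hwpos) hS
    (by rwa [hw, hθ])

/-- **Thresholding** (Cor. 22: "output `1` if `p̃ ≥ 1/2`"): if `ε + η < 1/6`, an oracle for which the `BQP`
promise holds at `x` but the bit `[t(A) ≥ 1/2]` is not the promised answer lies in the deviation event
`|t(A) − p_x(A)| > ε + η`. [cite: AaronsonAmbainis2014, proof of Cor. 22 and Thm. 23 (p. 14)] -/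
theorem threshold_subset_deviation (t : RealDecisionTree (numOracleBits F x)) {ε η : ℝ} (hεη : ε + η < 1 / 6) :
    {A : Set (List Bool) |
        (2 / 3 ≤ F.acceptProbOn A x ∧ decide (1 / 2 ≤ t.eval (oracleBits F x A)) ≠ true) ∨
          (F.acceptProbOn A x ≤ 1 / 3 ∧ decide (1 / 2 ≤ t.eval (oracleBits F x A)) ≠ false)} ⊆
      {A : Set (List Bool) | ε + η < |t.eval (oracleBits F x A) - F.acceptProbOn A x|} := by
  intro A hA
  simp only [Set.mem_setOf_eq, ne_eq, decide_eq_true_eq, decide_eq_false_iff_not, not_le, not_lt] at hA ⊢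
  rcases hA with ⟨hp, ht⟩ | ⟨hp, ht⟩
  · rw [abs_sub_comm, abs_of_nonneg (by linarith)]; linarith
  · rw [abs_of_nonneg (by linarith)]; linarith

end Measure

/-! ### Dyadic rounding of the PB-AA constant -/

/-- **PB-AA with a dyadic constant.** If the PB-AA influence bound holds with constant `C₀ > 0`, it holds with
some dyadic constant `2^{-k} ≤ C₀` (the machine computes with rational thresholds). [folklore] -/
theorem pbBound_dyadic {c : ℕ} {C₀ : ℝ} (hC₀ : 0 < C₀)
    (HPB : ∀ (N T : ℕ) (p : MvPolynomial (Fin N) ℝ) (ε : ℝ), 1 ≤ T → PseudoBounded T p → 0 < ε →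
      ε ≤ boolVariance p → ∃ i : Fin N, C₀ * (ε / T) ^ c ≤ influence i p) :
    ∃ k : ℕ, ∀ (N T : ℕ) (p : MvPolynomial (Fin N) ℝ) (ε : ℝ), 1 ≤ T → PseudoBounded T p → 0 < ε →
      ε ≤ boolVariance p → ∃ i : Fin N, (1 / 2 ^ k : ℝ) * (ε / T) ^ c ≤ influence i p := by
  obtain ⟨k, hk⟩ := exists_pow_lt_of_lt_one hC₀ (by norm_num : (1 / 2 : ℝ) < 1)
  refine ⟨k, fun N T p ε hT hp hε hv => ?_⟩
  obtain ⟨i, hi⟩ := HPB N T p ε hT hp hε hv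
  refine ⟨i, le_trans ?_ hi⟩
  have hpow : (1 / 2 ^ k : ℝ) ≤ C₀ := by
    rw [one_div, ← inv_pow]
    have : ((1 / 2 : ℝ)) ^ k = (2⁻¹ : ℝ) ^ k := by norm_num
    rw [← this]
    exact hk.le
  have hnn : 0 ≤ (ε / T) ^ c := by positivity
  exact mul_le_mul_of_nonneg_right hpow hnn

/-! ### The reduction -/

/-- **`OracleSimulation` from the machine half.** Granted the pseudo-boundedness of oracle acceptance
polynomials (stub 1, any proof of its statement) and PB-AA, the MACHINE HYPOTHESIS spelled out in the module
docstring — for all `c k`, every uniform `F` and polynomial `r`: one `Q ∈ PromiseBQP` and one polynomial-time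
transcript machine which, for every `x` (`n ≥ 1`) and every `g` correct on `Q`'s promise, outputs with the
combined oracle `A ⊕ g` the threshold bit of the no-variance advised tree driven by `w`-vs-`w/2` faithful
influence answers and `1/20`-accurate estimates of the restricted acceptance probabilities, at the explicit
parameters `δ = 1/(r(n)+1)`, `θ = (1/10)²δ/2`, `w = 2^{-k}((θ/2)/d)^c`, `d = thm23Degree F x`, budget
`⌈8d/((w/2)δ)⌉` — yields Aaronson–Ambainis' average-case simulation relative to the promise oracle: the error
event has measure `≤ 1/(r(n)+1)`. [cite: AaronsonAmbainis2014, Thm. 23 (proof, p. 14)] -/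
theorem oracleSimulation_of_machines
    (hmach : ∀ (c k : ℕ) (F : QCircuitFamily cliffordT), F.IsUniform → ∀ r : Polynomial ℕ,
      ∃ Q ∈ Literature.Computability.Cryptography.PromiseBQP, ∃ (C : OracleAlg Bool) (q : Polynomial ℕ),
        C.IsPolyTime Computability.encodingBoolBool ∧
        (∀ (O : Oracle) (x : List Bool), ∀ y ∈ C.queries O (q.eval x.length) x, y.length ≤ q.eval x.length) ∧
        ∀ x : List Bool, 1 ≤ x.length → ∀ g : List Bool → Bool,
          (∀ v ∈ Q.yes, g v = true) → (∀ v ∈ Q.no, g v = false) →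
          ∃ (infBig : List (Fin (numOracleBits F x) × Bool) → Fin (numOracleBits F x) → Bool)
            (est : List (Fin (numOracleBits F x) × Bool) → ℝ),
            (∀ (ρ : List (Fin (numOracleBits F x) × Bool)) (i : Fin (numOracleBits F x)),
              ((1 / 2 ^ k : ℝ) * ((((1 / 10 : ℝ) ^ 2 * (1 / (((r.eval x.length : ℕ) : ℝ) + 1)) / 2) / 2) /
                    thm23Degree F x) ^ c ≤ influence i (restrictPath ρ (acceptPoly F x)) → infBig ρ i = true) ∧
              (influence i (restrictPath ρ (acceptPoly F x)) ≤
                  ((1 / 2 ^ k : ℝ) * ((((1 / 10 : ℝ) ^ 2 * (1 / (((r.eval x.length : ℕ) : ℝ) + 1)) / 2) / 2) /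
                    thm23Degree F x) ^ c) / 2 → infBig ρ i = false)) ∧
            (∀ ρ : List (Fin (numOracleBits F x) × Bool),
              |est ρ - boolAvg (evalBool (restrictPath ρ (acceptPoly F x)))| ≤ 1 / 20) ∧
            ∀ A : Set (List Bool),
              C.run (Oracle.ofLanguage {w : List Bool | ∃ v : List Bool,
                  (w = false :: v ∧ v ∈ A) ∨ (w = true :: v ∧ g v = true)}) (q.eval x.length) x =
                some (decide (1 / 2 ≤
                  (advTree (gapAdvisor ⟨fun _ => true, infBig, est⟩)
                    (Nat.ceil (8 * (thm23Degree F x : ℝ) /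
                      (((1 / 2 ^ k : ℝ) * ((((1 / 10 : ℝ) ^ 2 * (1 / (((r.eval x.length : ℕ) : ℝ) + 1)) / 2) / 2) /
                          thm23Degree F x) ^ c) / 2 * (1 / (((r.eval x.length : ℕ) : ℝ) + 1)))))
                    []).eval (oracleBits F x A)))) :
    Sig.stub_oracleAcceptPseudoBounded → PseudoBoundedAA → OracleSimulation := by
  intro h₁ hPB F hF r
  obtain ⟨c, C₀, hC₀, HPB⟩ := pbInfluenceBound_of_pseudoBoundedAA hPB
  obtain ⟨k, HPBk⟩ := pbBound_dyadic hC₀ HPB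
  obtain ⟨Q, hQ, C, q, hCpoly, hCq, hC⟩ := hmach c k F hF r
  refine ⟨Q, hQ, C, q, hCpoly, hCq, fun x hx g hgy hgn => ?_⟩
  obtain ⟨infBig, est, hinf, hest, hrun⟩ := hC x hx g hgy hgn
  -- parameters
  set δ : ℝ := 1 / (((r.eval x.length : ℕ) : ℝ) + 1) with hδ
  have hδpos : 0 < δ := by positivity
  have hε : (0 : ℝ) < 1 / 10 := by norm_num
  have hCk : (0 : ℝ) < 1 / 2 ^ k := by positivity
  set D : ℕ := Nat.ceil (8 * (thm23Degree F x : ℝ) /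
    (((1 / 2 ^ k : ℝ) * (((((1 / 10 : ℝ)) ^ 2 * δ / 2) / 2) / thm23Degree F x) ^ c) / 2 * δ)) with hD
  have hDle : 8 * (thm23Degree F x : ℝ) /
      (((1 / 2 ^ k : ℝ) * (((((1 / 10 : ℝ)) ^ 2 * δ / 2) / 2) / thm23Degree F x) ^ c) / 2 * δ) ≤ D :=
    Nat.le_ceil _
  have hdev := measure_advTree_noVar_deviation_le_pb F x hCk HPBk (h₁ F x) hε hδpos
    (η := 1 / 20) (infBig := infBig) (est := est) hinf hest hDle
  have hsub := threshold_subset_deviation F x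
    (advTree (gapAdvisor ⟨fun _ => true, infBig, est⟩) D []) (ε := 1 / 10) (η := 1 / 20) (by norm_num)
  -- rewrite the run of `C` into the threshold bit and conclude
  have hset : {A : Set (List Bool) |
      (2 / 3 ≤ F.acceptProbOn A x ∧
        C.run (Oracle.ofLanguage {w : List Bool | ∃ v : List Bool,
            (w = false :: v ∧ v ∈ A) ∨ (w = true :: v ∧ g v = true)}) (q.eval x.length) x ≠ some true) ∨
      (F.acceptProbOn A x ≤ 1 / 3 ∧
        C.run (Oracle.ofLanguage {w : List Bool | ∃ v : List Bool,
            (w = false :: v ∧ v ∈ A) ∨ (w = true :: v ∧ g v = true)}) (q.eval x.length) x ≠ some false)} =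
      {A : Set (List Bool) |
        (2 / 3 ≤ F.acceptProbOn A x ∧
            decide (1 / 2 ≤ (advTree (gapAdvisor ⟨fun _ => true, infBig, est⟩) D []).eval
              (oracleBits F x A)) ≠ true) ∨
          (F.acceptProbOn A x ≤ 1 / 3 ∧
            decide (1 / 2 ≤ (advTree (gapAdvisor ⟨fun _ => true, infBig, est⟩) D []).eval
              (oracleBits F x A)) ≠ false)} := by
    ext A
    simp only [Set.mem_setOf_eq, hrun A, ne_eq, Option.some.injEq]
  show (ProbabilityTheory.setBernoulli (Set.univ : Set (List Bool)) ⟨1 / 2, by norm_num, by norm_num⟩) _ ≤ _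
  change randomOracleMeasure _ ≤ _
  rw [hset]
  exact (measure_mono hsub).trans hdev

/-- **Stub `stub_pbOracleSimulation` from its machine.** The registered stub
`Sig.stub_pbOracleSimulation = Sig.stub_oracleAcceptPseudoBounded → PseudoBoundedAA → OracleSimulation`
follows from the machine hypothesis of `oracleSimulation_of_machines` alone (everything about queries,
influences, restrictions and measure being proved). [cite: AaronsonAmbainis2014, Thm. 23 (proof, p. 14)] -/
theorem stub_pbOracleSimulation_of_machines
    (hmach : ∀ (c k : ℕ) (F : QCircuitFamily cliffordT), F.IsUniform → ∀ r : Polynomial ℕ,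
      ∃ Q ∈ Literature.Computability.Cryptography.PromiseBQP, ∃ (C : OracleAlg Bool) (q : Polynomial ℕ),
        C.IsPolyTime Computability.encodingBoolBool ∧
        (∀ (O : Oracle) (x : List Bool), ∀ y ∈ C.queries O (q.eval x.length) x, y.length ≤ q.eval x.length) ∧
        ∀ x : List Bool, 1 ≤ x.length → ∀ g : List Bool → Bool,
          (∀ v ∈ Q.yes, g v = true) → (∀ v ∈ Q.no, g v = false) →
          ∃ (infBig : List (Fin (numOracleBits F x) × Bool) → Fin (numOracleBits F x) → Bool)
            (est : List (Fin (numOracleBits F x) × Bool) → ℝ),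
            (∀ (ρ : List (Fin (numOracleBits F x) × Bool)) (i : Fin (numOracleBits F x)),
              ((1 / 2 ^ k : ℝ) * ((((1 / 10 : ℝ) ^ 2 * (1 / (((r.eval x.length : ℕ) : ℝ) + 1)) / 2) / 2) /
                    thm23Degree F x) ^ c ≤ influence i (restrictPath ρ (acceptPoly F x)) → infBig ρ i = true) ∧
              (influence i (restrictPath ρ (acceptPoly F x)) ≤
                  ((1 / 2 ^ k : ℝ) * ((((1 / 10 : ℝ) ^ 2 * (1 / (((r.eval x.length : ℕ) : ℝ) + 1)) / 2) / 2) /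
                    thm23Degree F x) ^ c) / 2 → infBig ρ i = false)) ∧
            (∀ ρ : List (Fin (numOracleBits F x) × Bool),
              |est ρ - boolAvg (evalBool (restrictPath ρ (acceptPoly F x)))| ≤ 1 / 20) ∧
            ∀ A : Set (List Bool),
              C.run (Oracle.ofLanguage {w : List Bool | ∃ v : List Bool,
                  (w = false :: v ∧ v ∈ A) ∨ (w = true :: v ∧ g v = true)}) (q.eval x.length) x =
                some (decide (1 / 2 ≤
                  (advTree (gapAdvisor ⟨fun _ => true, infBig, est⟩)
                    (Nat.ceil (8 * (thm23Degree F x : ℝ) /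
                      (((1 / 2 ^ k : ℝ) * ((((1 / 10 : ℝ) ^ 2 * (1 / (((r.eval x.length : ℕ) : ℝ) + 1)) / 2) / 2) /
                          thm23Degree F x) ^ c) / 2 * (1 / (((r.eval x.length : ℕ) : ℝ) + 1)))))
                    []).eval (oracleBits F x A)))) :
    Sig.stub_pbOracleSimulation :=
  oracleSimulation_of_machines hmach

end SimTreePB

end Summit.QuantumAdvantage.QuantumAdvantage.Cruxes.TransferPB.Birth

end
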